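import Summits.QuantumFields.BalabanUV.T4Continuum.Spine.NE9.DirectPairingPropagationCarriers

/-!
# T⁴ programme, spine estimate NE9 — THE HOLOMORPHIC-MARGIN CHANNEL: King's RUN-UNIFORM step clauses [UC-OLD] ∕ [UC-LAST] (census C33)
# on the NON-COMPACT inductive class, and the volume-uniform modulus of census C35 (source (c)), from HOLOMORPHY ON A UNIFORM COMPLEX
# THICKENING + A RUN-UNIFORM BOUND THERE (Cauchy ∕ Schwarz along complex segments); two-sided: the COMPLEX bound is load-bearing
# — census item C37 of cell `pub-balaban-gaps`, seat ne9 (gen 9)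

Cell `pub-balaban-gaps` (YM blitz G2, seat ne9, unit `pub-balaban-gaps-ne9-g9`; record `run/shared/lean/pub/pub-balaban-gaps/ne/NE9.md` §5
row C37).  Summits-side bookkeeping; complex∕real analysis on hypothesis SHAPES; NO definition; nothing of Bałaban's asserted.

CONTEXT (census C33 ∕ C35, gens 7–8).  In King's direct-pairing currency, GIVEN tower-NE5, node U3 → U6 (and U5b) consume from the E-side
exactly the two STEP clauses of `DirectPairingPropagation.propagate`: [UC-OLD] (per level, the step `Φ s j c` is uniformly continuous in the
OLD data on the inductive class `A j`, with ONE modulus for every member `s` of the family — the RUNS, i.e. the tori of all sizes, C35 — and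
every last coupling `c`) and [UC-LAST] (uniformly continuous in the LAST coupling, one modulus for every run and every class-valued old datum).
Gen 7 obtained both for ONE run from joint continuity on a COMPACT `I × A j` (`sepUC_hyps_of_compact`) and showed the uniformity is
load-bearing off compactness (`crossTower_not_sepUC`); gen 8 obtained the RUN-uniformity from per-run continuity + STABILISATION in the run
(`DirectPairingRunLimit.stepUC_of_stabilising`, source (b)) and listed a third sufficient source (c) «a volume-uniform quantitative
modulus (printed KIND)» without typing it.  For Bałaban's step the class `A j` is NOT compact: it is the (1.18)-ball
`{E : ‖E‖_κ ≤ E₀}` of an infinite-dimensional Banach space of analytic activities ([Balaban1987RG1] (1.18) p. 263, Thm 3 p. 264), and the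
record's phrase for [UC-OLD] — *"an analytic, hence locally uniformly continuous, channel"* (C33) — does NOT give a modulus uniform over
a bounded non-compact class, let alone over the runs.

WHAT IS PROVED (0 sorry; the engine is the tree's Banach-space Cauchy∕Schwarz estimate
`Literature.MathematicalPhysics.QuantumFieldTheory.Dimock2015.AnalyticLipschitz.norm_sub_le_of_margin`: holomorphic on `D`, `‖·‖ ≤ M` on
`D`, closed `ϱ`-balls about the comparison set inside `D` ⇒ Lipschitz `4M∕ϱ` on the comparison set).
* §1 `lipschitzOld_of_margin` ∕ `uniformOld_of_margin`: (AN-OLD)+MARGIN — per level ONE margin `ϱ > 0` and ONE bound `M` such that for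
  every run `s` and last coupling `c ∈ I` the step `Φ s j c : F → F` is complex differentiable on a set containing the closed `ϱ`-balls
  about the class `A j` and bounded by `M` there ⇒ a RUN-UNIFORM LIPSCHITZ modulus `4M∕ϱ` in the old data on the class (C35's source (c),
  typed) ⇒ [UC-OLD] VERBATIM (the `hold` binder of `propagate` ∕ `sepUC_carriers_of_propagation` ∕ `king_U6_of_propagation`).
  `lipschitzLast_of_margin` ∕ `uniformLast_of_margin`: (AN-LAST)+MARGIN — per level ONE `ϱ`, `M` such that for every run and every
  class-valued old datum the real-coupling map `c ↦ Φ s j c w` on `I` is the restriction of a function holomorphic on a set containing the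
  closed complex `ϱ`-discs about `I`, bounded by `M` ⇒ Lipschitz `4M∕ϱ` ⇒ [UC-LAST] VERBATIM (`hlast`).  The SIZE of `4M∕ϱ` is
  irrelevant (King's currency composes no constant: C33) — no clause N2, no renewal.
* §2 `margin_of_relDisc` ∕ `uniformLast_of_relDisc`: on node U2's NATIVE t-box `[t₀, ∞[` the RELATIVE discs `|z − t| ≤ c·|t|` of the
  analytic branch ([H-dil], `AnalyticBranchPropagation.NormCouplingAnalyticRel`'s disc shape; [Balaban1987RG1] p. 266) CONTAIN the uniform
  discs of radius `c·t₀`: in the t-currency [H-dil] + a run-uniform bound IS a margin, hence [UC-LAST].  (In the g-currency on `]0, γ]`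
  relative discs shrink at `g → 0` and carry no margin; print's C^∞ clause is on the CLOSED `[0, γ]`, [I] p. 263.)
* §3 `king_U6_of_margin` ∕ `directBracket_eventually_le_carriers_of_margin`: the ENDs of King's currency on the tower of carriers BY NAME
  (`DirectPairingPropagationCarriers.king_U6_of_propagation` ∕ `directBracket_eventually_le_carriers_of_propagation`) with `hold`, `hlast`
  DISCHARGED by §1: E-side inputs = tower-NE5 + one Markov recursion per run whose steps have (AN-OLD)+margin and (AN-LAST)+margin with
  run-uniform `ϱ_j`, `M_j` + uniformly continuous read-outs.  `sepUC_of_margin`: the family form (`sepUC_of_propagation`).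
* §4 TWO-SIDEDNESS — THE COMPLEX BOUND IS LOAD-BEARING.  The run-indexed family `c ↦ sin(n·c)` (run `n`) on `I = [0, 1]`:
  `sinFamily_entire` (each member is the restriction of an ENTIRE function — holomorphic on EVERY thickening), `sinFamily_realBounded`
  (bounded by `1` on the REAL class, uniformly in `n`), `sinFamily_perMember` (each member uniformly continuous — per-run moduli, gen 7's
  compact case), yet `sinFamily_not_uniformLast` (NO run-uniform modulus: `c = 0` against `π∕(2n)`) — and indeed
  `sinFamily_unbounded_on_thickening` (`‖sin(n·iϱ)‖ = sinh(nϱ) ≥ nϱ`: no run-uniform bound on ANY complex thickening).  So among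
  {holomorphy on a uniform thickening, run-uniform bound on the REAL class, per-run moduli} nothing gives the run-uniform clause; the
  run-uniform bound on the COMPLEX thickening does (§1).  `flipFamily_margin_not_stabilising`: the margin source (c) is NOT contained in
  gen 8's stabilisation source (b) — the family `c ↦ (−1)^n·c` has margin `1` and bound `2` on the `1`-thickening of `[0, 1]` for every
  run (so §1 applies) but does not stabilise in the run.

READING FOR BAŁABAN (H∃, printed KIND; nothing asserted).  (AN-OLD)+margin: the old action enters the fluctuation integral LINEARLY
through the potentials of [Balaban1988RG2Cluster] Lemma 1 (1.33)–(1.36) p. 9 and the cluster expansion (2.14)–(2.20) pp. 15–17 is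
analytic in them and converges *"for κ sufficiently large"* — a margin is the expansion's tolerance of activities of norm `(1 + r)E₀`
beyond the class radius `E₀`, the bound `M` is E₀-reproduction on that thickening (p. 21); RUN-uniformity of `(ϱ, M)` = independence
of the torus = [Balaban1987RG1] Thm 1 p. 259 *"uniform in the lattice spacing ε"* (printed KIND of every constant of the series).
(AN-LAST)+margin: [I] p. 263 *"C^∞-function of g_{j−1} ∈ [0, γ], (or analytic)"*, p. 266 the analytic branch (relative discs; in the
t-currency a margin, §2); the bound = (1.18) on the complex domain.  Both are statements about the ONE-STEP object (locus W1, instance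
0∕1).  CLASSIFICATION OF NE9 UNCHANGED: WORK-bound (W1); what this file changes is the STATUS of the last two «uniformity» residues of
the King-currency E-side list (C33's [UC-OLD] on the non-compact class «inspection-level», C35's source (c) «untyped»): both are now
kernel consequences of ONE clause of printed KIND — holomorphy with a volume-uniform margin and bound — and that clause is two-sided.

HONEST FRAMING: bookkeeping for rung (B)+1 on ONE FIXED finite four-torus; analysis on hypothesis SHAPES; tower-NE5 is the cell's
estimate NE5 (NOT PRINTED, NOT PROVED); (AN-OLD)∕(AN-LAST)+margin for Bałaban's step are NOT PRINTED as theorems and NOT PROVED; NE9 NOT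
PRINTED ∕ NOT PROVED; spine PROVED 0∕9 unchanged; instance 0∕1; NOT UV stability, NOT the continuum limit, NOT infinite volume, NOT a
mass gap, NOT Clay.  HONEST DEPENDENCY: continuum YM on T⁴ ⇐ BetaPertH ∧ nine spine estimates (0∕9 proved); BetaPertH ⇐ (D1) ∧ (D4) ∧
CAP+tail.

References (TYPES only): [Balaban1987RG1] = T. Bałaban, Commun. Math. Phys. **109** (1987) 249–301, p. 256, Thm 1 p. 259, (1.18) p. 263,
Thm 3 p. 264, p. 266; [Balaban1988RG2Cluster] = T. Bałaban, Commun. Math. Phys. **116** (1988) 1–22, Lemma 1 (1.33)–(1.36) p. 9,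
(2.14)–(2.20) pp. 15–17, p. 21; [King1986] = C. King, Commun. Math. Phys. **102** (1986) 649–677, §3.2; [Dimock2015] = J. Dimock,
arXiv:1512.04373, Sect. 7 (the Cauchy-estimate mechanism, tree file `Dimock2015/AnalyticLipschitz`).
-/

namespace Summit.QuantumFields.BalabanUV.T4Continuum.NE9.DirectPairingMargin

open scoped BigOperators
open Filter Topology Metric Set
open Literature.MathematicalPhysics.QuantumFieldTheory.Balaban1983to89
open Literature.MathematicalPhysics.QuantumFieldTheory.Balaban1983to89.T4CouplingAnalyticity (BoxWindow)
open Literature.MathematicalPhysics.QuantumFieldTheory.Dimock2015 (norm_sub_le_of_margin)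
open T4CauchySum (delta)
open Summit.QuantumFields.BalabanUV.T4Continuum.NE9.TowerCarriers
open Summit.QuantumFields.BalabanUV.T4Continuum.NE9.TowerCarriersBox (TowerNE5On)
open Summit.QuantumFields.BalabanUV.T4Continuum.NE9.DirectPairingPropagation (sepUC_of_propagation)
open Summit.QuantumFields.BalabanUV.T4Continuum.NE9.DirectPairingPropagationCarriers
  (king_U6_of_propagation directBracket_eventually_le_carriers_of_propagation)

variable {F : Type*} [NormedAddCommGroup F] [NormedSpace ℂ F] [CompleteSpace F]

/-! ## §1 The margin lemma in the two variables of the step: [UC-OLD] and [UC-LAST] run-uniformly on a non-compact class -/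

section Step

variable {σ : Type*} {Φ : σ → ℕ → ℝ → F → F} {A : ℕ → Set F} {I : Set ℝ}

/-- **(AN-OLD)+MARGIN ⇒ A RUN-UNIFORM LIPSCHITZ MODULUS IN THE OLD DATA ON THE CLASS** (census C35's source (c), typed): per level `j`, if
ONE margin `ϱ > 0` and ONE bound `M` serve every member `s` and every last coupling `c ∈ I` — `Φ s j c` complex differentiable on a set
containing the closed `ϱ`-balls about `A j`, `‖Φ s j c ·‖ ≤ M` there — then `‖Φ s j c w − Φ s j c w'‖ ≤ (4M∕ϱ)‖w − w'‖` on `A j` for EVERY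
`s`, `c`.  The class may be any bounded non-compact set of a complex Banach space. [folklore] -/
theorem lipschitzOld_of_margin
    (hO : ∀ j, ∃ ϱ M : ℝ, 0 < ϱ ∧ ∀ s, ∀ c ∈ I, ∃ D : Set F,
      DifferentiableOn ℂ (Φ s j c) D ∧ (∀ z ∈ D, ‖Φ s j c z‖ ≤ M) ∧ ∀ w ∈ A j, closedBall w ϱ ⊆ D) (j : ℕ) :
    ∃ L : ℝ, 0 ≤ L ∧ ∀ s, ∀ c ∈ I, ∀ w ∈ A j, ∀ w' ∈ A j, ‖Φ s j c w - Φ s j c w'‖ ≤ L * ‖w - w'‖ := by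
  obtain ⟨ϱ, M, hϱ, h⟩ := hO j
  refine ⟨max (4 * M / ϱ) 0, le_max_right _ _, fun s c hc w hw w' hw' => ?_⟩
  obtain ⟨D, hD, hM, hA⟩ := h s c hc
  calc ‖Φ s j c w - Φ s j c w'‖ ≤ 4 * M / ϱ * ‖w - w'‖ := norm_sub_le_of_margin hϱ hD hM hA hw hw'
    _ ≤ max (4 * M / ϱ) 0 * ‖w - w'‖ := mul_le_mul_of_nonneg_right (le_max_left _ _) (norm_nonneg _)

/-- **(AN-OLD)+MARGIN ⇒ [UC-OLD] RUN-UNIFORMLY** — literally the `hold` binder of `DirectPairingPropagation.propagate` (family index `s`,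
state space the complex Banach space `F` with its metric): ONE `δ = ε·min(ϱ∕4M, 1)`-type threshold for every member, last coupling and pair
of class elements.  No compactness, no stabilisation; the size of the constant is never used downstream. [folklore] -/
theorem uniformOld_of_margin
    (hO : ∀ j, ∃ ϱ M : ℝ, 0 < ϱ ∧ ∀ s, ∀ c ∈ I, ∃ D : Set F,
      DifferentiableOn ℂ (Φ s j c) D ∧ (∀ z ∈ D, ‖Φ s j c z‖ ≤ M) ∧ ∀ w ∈ A j, closedBall w ϱ ⊆ D) :
    ∀ j, ∀ ε : ℝ, 0 < ε → ∃ δ : ℝ, 0 < δ ∧ ∀ s, ∀ c ∈ I, ∀ w ∈ A j, ∀ w' ∈ A j,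
      dist w w' ≤ δ → dist (Φ s j c w) (Φ s j c w') ≤ ε := by
  intro j ε hε
  obtain ⟨L, hL0, hL⟩ := lipschitzOld_of_margin hO j
  have hL1 : 0 < L + 1 := by linarith
  refine ⟨ε / (L + 1), div_pos hε hL1, fun s c hc w hw w' hw' hd => ?_⟩
  rw [dist_eq_norm] at hd ⊢
  calc ‖Φ s j c w - Φ s j c w'‖ ≤ L * ‖w - w'‖ := hL s c hc w hw w' hw'
    _ ≤ (L + 1) * ‖w - w'‖ := mul_le_mul_of_nonneg_right (by linarith) (norm_nonneg _)
    _ ≤ (L + 1) * (ε / (L + 1)) := mul_le_mul_of_nonneg_left hd hL1.le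
    _ = ε := mul_div_cancel₀ ε hL1.ne'

/-- **(AN-LAST)+MARGIN ⇒ A RUN-UNIFORM LIPSCHITZ MODULUS IN THE LAST COUPLING**: per level `j`, if ONE margin `ϱ > 0` and ONE bound `M`
serve every member `s` and every class-valued old datum `w ∈ A j` — the real-coupling map `c ↦ Φ s j c w` on `I` is the restriction of some
`Ψ : ℂ → F` complex differentiable on a set containing the closed `ϱ`-discs about `I`, `‖Ψ‖ ≤ M` there — then
`‖Φ s j c w − Φ s j c' w‖ ≤ (4M∕ϱ)|c − c'|` on `I` for EVERY `s`, `w`. [folklore] -/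
theorem lipschitzLast_of_margin
    (hLa : ∀ j, ∃ ϱ M : ℝ, 0 < ϱ ∧ ∀ s, ∀ w ∈ A j, ∃ (Ψ : ℂ → F) (D : Set ℂ),
      DifferentiableOn ℂ Ψ D ∧ (∀ z ∈ D, ‖Ψ z‖ ≤ M) ∧ (∀ c ∈ I, closedBall (c : ℂ) ϱ ⊆ D) ∧ ∀ c ∈ I, Ψ c = Φ s j c w)
    (j : ℕ) :
    ∃ L : ℝ, 0 ≤ L ∧ ∀ s, ∀ w ∈ A j, ∀ c ∈ I, ∀ c' ∈ I, ‖Φ s j c w - Φ s j c' w‖ ≤ L * |c - c'| := by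
  obtain ⟨ϱ, M, hϱ, h⟩ := hLa j
  refine ⟨max (4 * M / ϱ) 0, le_max_right _ _, fun s w hw c hc c' hc' => ?_⟩
  obtain ⟨Ψ, D, hΨ, hM, hI, hres⟩ := h s w hw
  have hS : ∀ y ∈ ((↑) : ℝ → ℂ) '' I, closedBall y ϱ ⊆ D := by
    rintro _ ⟨c₀, hc₀, rfl⟩
    exact hI c₀ hc₀
  have key := norm_sub_le_of_margin hϱ hΨ hM hS (mem_image_of_mem _ hc) (mem_image_of_mem _ hc')
  rw [hres c hc, hres c' hc', ← Complex.ofReal_sub, Complex.norm_real, Real.norm_eq_abs] at key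
  calc ‖Φ s j c w - Φ s j c' w‖ ≤ 4 * M / ϱ * |c - c'| := key
    _ ≤ max (4 * M / ϱ) 0 * |c - c'| := mul_le_mul_of_nonneg_right (le_max_left _ _) (abs_nonneg _)

/-- **(AN-LAST)+MARGIN ⇒ [UC-LAST] RUN-UNIFORMLY** — literally the `hlast` binder of `DirectPairingPropagation.propagate`. [folklore] -/
theorem uniformLast_of_margin
    (hLa : ∀ j, ∃ ϱ M : ℝ, 0 < ϱ ∧ ∀ s, ∀ w ∈ A j, ∃ (Ψ : ℂ → F) (D : Set ℂ),
      DifferentiableOn ℂ Ψ D ∧ (∀ z ∈ D, ‖Ψ z‖ ≤ M) ∧ (∀ c ∈ I, closedBall (c : ℂ) ϱ ⊆ D) ∧ ∀ c ∈ I, Ψ c = Φ s j c w) :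
    ∀ j, ∀ ε : ℝ, 0 < ε → ∃ δ : ℝ, 0 < δ ∧ ∀ s, ∀ w ∈ A j, ∀ c ∈ I, ∀ c' ∈ I,
      |c - c'| ≤ δ → dist (Φ s j c w) (Φ s j c' w) ≤ ε := by
  intro j ε hε
  obtain ⟨L, hL0, hL⟩ := lipschitzLast_of_margin hLa j
  have hL1 : 0 < L + 1 := by linarith
  refine ⟨ε / (L + 1), div_pos hε hL1, fun s w hw c hc c' hc' hd => ?_⟩
  rw [dist_eq_norm]
  calc ‖Φ s j c w - Φ s j c' w‖ ≤ L * |c - c'| := hL s w hw c hc c' hc'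
    _ ≤ (L + 1) * |c - c'| := mul_le_mul_of_nonneg_right (by linarith) (abs_nonneg _)
    _ ≤ (L + 1) * (ε / (L + 1)) := mul_le_mul_of_nonneg_left hd hL1.le
    _ = ε := mul_div_cancel₀ ε hL1.ne'

end Step

/-! ## §2 The t-currency: relative discs on `[t₀, ∞[` carry a uniform margin -/

/-- **RELATIVE DISCS ON THE t-BOX CONTAIN UNIFORM DISCS**: if `D` contains the closed discs `|z − t| ≤ c·|t|` about every `t ≥ t₀ > 0` (the
[H-dil] shape of the analytic branch, `AnalyticBranchPropagation.NormCouplingAnalyticRel`), then it contains the closed discs of the FIXED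
radius `c·t₀` about every such `t` — [H-dil] on node U2's native t-box is a margin. [folklore] -/
theorem margin_of_relDisc {t₀ c : ℝ} (hc : 0 ≤ c) {D : Set ℂ}
    (hD : ∀ t ∈ Ici t₀, closedBall (t : ℂ) (c * |t|) ⊆ D) : ∀ t ∈ Ici t₀, closedBall (t : ℂ) (c * t₀) ⊆ D :=
  fun t ht => (closedBall_subset_closedBall
    (mul_le_mul_of_nonneg_left ((mem_Ici.mp ht).trans (le_abs_self t)) hc)).trans (hD t ht)

/-- **[H-dil] + A RUN-UNIFORM BOUND ⇒ [UC-LAST] ON THE t-BOX**: per level ONE relative-disc constant `c > 0` and ONE bound `M` for every run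
and every class-valued old datum ⇒ the `hlast` binder of `propagate` with `I = [t₀, ∞[`, by `uniformLast_of_margin` at the margin
`c·t₀`. [folklore] -/
theorem uniformLast_of_relDisc {σ : Type*} {Φ : σ → ℕ → ℝ → F → F} {A : ℕ → Set F} {t₀ c : ℝ} (ht₀ : 0 < t₀)
    (hc : 0 < c)
    (hLa : ∀ j, ∃ M : ℝ, ∀ s, ∀ w ∈ A j, ∃ (Ψ : ℂ → F) (D : Set ℂ),
      DifferentiableOn ℂ Ψ D ∧ (∀ z ∈ D, ‖Ψ z‖ ≤ M) ∧ (∀ t ∈ Ici t₀, closedBall (t : ℂ) (c * |t|) ⊆ D) ∧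
        ∀ t ∈ Ici t₀, Ψ t = Φ s j t w) :
    ∀ j, ∀ ε : ℝ, 0 < ε → ∃ δ : ℝ, 0 < δ ∧ ∀ s, ∀ w ∈ A j, ∀ t ∈ Ici t₀, ∀ t' ∈ Ici t₀,
      |t - t'| ≤ δ → dist (Φ s j t w) (Φ s j t' w) ≤ ε := by
  refine uniformLast_of_margin fun j => ?_
  obtain ⟨M, h⟩ := hLa j
  refine ⟨c * t₀, M, mul_pos hc ht₀, fun s w hw => ?_⟩
  obtain ⟨Ψ, D, hΨ, hM, hD, hres⟩ := h s w hw
  exact ⟨Ψ, D, hΨ, hM, margin_of_relDisc hc.le hD, hres⟩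

/-! ## §3 The ENDs of King's currency on the tower of carriers BY NAME, with the step clauses discharged by margins -/

section Carriers

variable (T : TowerData) {E : ℕ → (ℕ → ℝ) → T.B → T.Dom → ℝ} {I : Set ℝ} {κ : ℝ}
  {V : ℕ → ℕ → (ℕ → ℝ) → F} {Φ : ℕ → ℕ → ℝ → F → F} {A : ℕ → Set F} {ev : ℕ → T.B → T.Dom → F → ℝ}

/-- **KING'S CURRENCY ON THE CARRIERS FROM MARGINS** (`DirectPairingPropagationCarriers.directBracket_eventually_le_carriers_of_propagation`
BY NAME): tower-NE5 + one Markov recursion per run `k` on a complex Banach space of activities with (AN-OLD)+margin and (AN-LAST)+margin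
(run-uniform `ϱ_j`, `M_j`) + uniformly continuous read-outs + a profile `P_i → 0` ⇒ ONE scale threshold beyond which every direct bracket
of the runs `k`, `k + n` is `≤ η·e^{−κd(X)}`, uniformly in `n`.  [UC-OLD]∕[UC-LAST] are no longer hypotheses. [folklore] -/
theorem directBracket_eventually_le_carriers_of_margin {θ C₅ : ℝ} {P : ℕ → ℝ}
    (hC : 0 ≤ C₅) (hθ0 : 0 ≤ θ) (hθ1 : θ < 1) (h5 : TowerNE5On T E I κ θ C₅)
    (h0 : ∀ k, ∀ g ∈ BoxWindow I, ∀ g' ∈ BoxWindow I, V k 0 g = V k 0 g')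
    (hrec : ∀ k j, ∀ g ∈ BoxWindow I, V k (j + 1) g = Φ k j (g j) (V k j g))
    (hmem : ∀ k m, ∀ g ∈ BoxWindow I, V k m g ∈ A m)
    (hO : ∀ j, ∃ ϱ M : ℝ, 0 < ϱ ∧ ∀ k, ∀ c ∈ I, ∃ D : Set F,
      DifferentiableOn ℂ (Φ k j c) D ∧ (∀ z ∈ D, ‖Φ k j c z‖ ≤ M) ∧ ∀ w ∈ A j, closedBall w ϱ ⊆ D)
    (hLa : ∀ j, ∃ ϱ M : ℝ, 0 < ϱ ∧ ∀ k, ∀ w ∈ A j, ∃ (Ψ : ℂ → F) (D : Set ℂ),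
      DifferentiableOn ℂ Ψ D ∧ (∀ z ∈ D, ‖Ψ z‖ ≤ M) ∧ (∀ c ∈ I, closedBall (c : ℂ) ϱ ⊆ D) ∧ ∀ c ∈ I, Ψ c = Φ k j c w)
    (hev : ∀ m, ∀ ε : ℝ, 0 < ε → ∃ δ : ℝ, 0 < δ ∧ ∀ (k : ℕ) (U : T.B) (X : T.Dom), T.r X + m = k →
      ∀ w ∈ A m, ∀ w' ∈ A m, dist w w' ≤ δ → Real.exp (κ * T.d X) * |ev k U X w - ev k U X w'| ≤ ε)
    (hE : ∀ (k : ℕ) (U : T.B) (X : T.Dom), ∀ g ∈ BoxWindow I, E k g U X = ev k U X (V k (k - T.r X) g))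
    (hd : Tendsto P atTop (𝓝 0)) {η : ℝ} (hη : 0 < η) :
    ∃ M₀ : ℕ, ∀ (k n : ℕ) (U : T.B) (X : T.Dom), T.r X + M₀ ≤ k →
      ∀ g ∈ BoxWindow I, ∀ g' ∈ BoxWindow I, (∀ i, i < k - T.r X → |g (i + n) - g' i| ≤ P i) →
        |E (k + n) g U X - E k g' (T.descend (k + n) U k) X| ≤ η * Real.exp (-(κ * T.d X)) :=
  directBracket_eventually_le_carriers_of_propagation T hC hθ0 hθ1 h5 h0 hrec hmem (uniformOld_of_margin hO)
    (uniformLast_of_margin hLa) hev hE hd hη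

/-- **NODE U6 IN KING'S CURRENCY FROM MARGINS** (`DirectPairingPropagationCarriers.king_U6_of_propagation` BY NAME): add the (1.18)-type
bound and node U2's summable consecutive matching profile ⇒ a scale profile `b_j → 0` dominating the direct bracket of the runs `K`, `K + n`
and `T4CauchySum.delta E₀ ρ inj K → 0` for every injection under it.  E-side inputs: tower-NE5, (AN-OLD)+margin, (AN-LAST)+margin,
read-outs — no modulus, no stabilisation, no statement about the coupling history. [folklore] -/
theorem king_U6_of_margin {θ C₅ B : ℝ} {p : ℕ → ℝ} {t : ℕ → ℕ → ℝ}
    (hC : 0 ≤ C₅) (hθ0 : 0 ≤ θ) (hθ1 : θ < 1) (h5 : TowerNE5On T E I κ θ C₅)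
    (h0 : ∀ k, ∀ g ∈ BoxWindow I, ∀ g' ∈ BoxWindow I, V k 0 g = V k 0 g')
    (hrec : ∀ k j, ∀ g ∈ BoxWindow I, V k (j + 1) g = Φ k j (g j) (V k j g))
    (hmem : ∀ k m, ∀ g ∈ BoxWindow I, V k m g ∈ A m)
    (hO : ∀ j, ∃ ϱ M : ℝ, 0 < ϱ ∧ ∀ k, ∀ c ∈ I, ∃ D : Set F,
      DifferentiableOn ℂ (Φ k j c) D ∧ (∀ z ∈ D, ‖Φ k j c z‖ ≤ M) ∧ ∀ w ∈ A j, closedBall w ϱ ⊆ D)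
    (hLa : ∀ j, ∃ ϱ M : ℝ, 0 < ϱ ∧ ∀ k, ∀ w ∈ A j, ∃ (Ψ : ℂ → F) (D : Set ℂ),
      DifferentiableOn ℂ Ψ D ∧ (∀ z ∈ D, ‖Ψ z‖ ≤ M) ∧ (∀ c ∈ I, closedBall (c : ℂ) ϱ ⊆ D) ∧ ∀ c ∈ I, Ψ c = Φ k j c w)
    (hev : ∀ m, ∀ ε : ℝ, 0 < ε → ∃ δ : ℝ, 0 < δ ∧ ∀ (k : ℕ) (U : T.B) (X : T.Dom), T.r X + m = k →
      ∀ w ∈ A m, ∀ w' ∈ A m, dist w w' ≤ δ → Real.exp (κ * T.d X) * |ev k U X w - ev k U X w'| ≤ ε)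
    (hE : ∀ (k : ℕ) (U : T.B) (X : T.Dom), ∀ g ∈ BoxWindow I, E k g U X = ev k U X (V k (k - T.r X) g))
    (hB0 : 0 ≤ B) (hB : ∀ (k : ℕ) (U : T.B) (X : T.Dom), ∀ g ∈ BoxWindow I, Real.exp (κ * T.d X) * |E k g U X| ≤ B)
    (ht : ∀ K, t K ∈ BoxWindow I) (hp : ∀ K i, |t (K + 1) (i + 1) - t K i| ≤ p i) (hp0 : ∀ i, 0 ≤ p i) (hps : Summable p) :
    ∃ b : ℕ → ℝ, (∀ j, 0 ≤ b j) ∧ Tendsto b atTop (𝓝 0) ∧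
      (∀ (K n : ℕ) (U : T.B) (X : T.Dom), T.r X ≤ K →
        |E (K + n) (t (K + n)) U X - E K (t K) (T.descend (K + n) U K) X| ≤ b (K - T.r X) * Real.exp (-(κ * T.d X))) ∧
      ∀ (E₀ ρ : ℝ) (inj : ℕ → ℕ → ℝ), 0 ≤ E₀ → 0 ≤ ρ → ρ < 1 →
        (∀ K j : ℕ, j ≤ K → 0 ≤ inj K j ∧ inj K j ≤ b j) → Tendsto (delta E₀ ρ inj) atTop (𝓝 0) :=
  king_U6_of_propagation T hC hθ0 hθ1 h5 h0 hrec hmem (uniformOld_of_margin hO) (uniformLast_of_margin hLa) hev hE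
    hB0 hB ht hp hp0 hps

end Carriers

/-- **THE FAMILY FORM** (`DirectPairingPropagation.sepUC_of_propagation` BY NAME, any family index `σ`): a coupling-free start, the Markov
recursion, class membership, (AN-OLD)+margin and (AN-LAST)+margin ⇒ separate uniform continuity of the states in EVERY young coupling, per
level, uniformly over the other couplings and the family — the `hUC` input of `DirectPairingFamily`. [folklore] -/
theorem sepUC_of_margin {σ : Type*} {I : Set ℝ} {V : σ → ℕ → (ℕ → ℝ) → F} {Φ : σ → ℕ → ℝ → F → F} {A : ℕ → Set F}
    (h0 : ∀ s, ∀ g ∈ BoxWindow I, ∀ g' ∈ BoxWindow I, V s 0 g = V s 0 g')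
    (hrec : ∀ s j, ∀ g ∈ BoxWindow I, V s (j + 1) g = Φ s j (g j) (V s j g))
    (hmem : ∀ s m, ∀ g ∈ BoxWindow I, V s m g ∈ A m)
    (hO : ∀ j, ∃ ϱ M : ℝ, 0 < ϱ ∧ ∀ s, ∀ c ∈ I, ∃ D : Set F,
      DifferentiableOn ℂ (Φ s j c) D ∧ (∀ z ∈ D, ‖Φ s j c z‖ ≤ M) ∧ ∀ w ∈ A j, closedBall w ϱ ⊆ D)
    (hLa : ∀ j, ∃ ϱ M : ℝ, 0 < ϱ ∧ ∀ s, ∀ w ∈ A j, ∃ (Ψ : ℂ → F) (D : Set ℂ),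
      DifferentiableOn ℂ Ψ D ∧ (∀ z ∈ D, ‖Ψ z‖ ≤ M) ∧ (∀ c ∈ I, closedBall (c : ℂ) ϱ ⊆ D) ∧ ∀ c ∈ I, Ψ c = Φ s j c w) :
    ∀ m i : ℕ, i < m → ∀ ε : ℝ, 0 < ε → ∃ δ : ℝ, 0 < δ ∧ ∀ s, ∀ g ∈ BoxWindow I, ∀ g' ∈ BoxWindow I,
      (∀ k, k ≠ i → g k = g' k) → |g i - g' i| ≤ δ → dist (V s m g) (V s m g') ≤ ε :=
  sepUC_of_propagation h0 hrec hmem (uniformOld_of_margin hO) (uniformLast_of_margin hLa)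

/-! ## §4 Two-sidedness: the COMPLEX bound is load-bearing; the margin source is not the stabilisation source -/

/-- The run-indexed family `c ↦ sin(n·c)` is the restriction to `ℝ` of the ENTIRE functions `z ↦ sin(n·z)`: holomorphic on every
thickening of every real class. [folklore] -/
theorem sinFamily_entire (n : ℕ) :
    Differentiable ℂ (fun z : ℂ => Complex.sin (n * z)) ∧ ∀ c : ℝ, Complex.sin (n * (c : ℂ)) = (Real.sin (n * c) : ℂ) := by
  refine ⟨?_, fun c => ?_⟩
  · exact Complex.differentiable_sin.comp (differentiable_id.const_mul (n : ℂ))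
  · push_cast
    rfl

/-- … bounded by `1` on the REAL class, uniformly in the run `n`. [folklore] -/
theorem sinFamily_realBounded (n : ℕ) (c : ℝ) : ‖Complex.sin (n * (c : ℂ))‖ ≤ 1 := by
  rw [(sinFamily_entire n).2 c, Complex.norm_real, Real.norm_eq_abs]
  exact Real.abs_sin_le_one _

/-- … and EACH member is uniformly continuous (Lipschitz `n`) — the per-run modulus of gen 7's compact case. [folklore] -/
theorem sinFamily_perMember (n : ℕ) :
    ∀ ε : ℝ, 0 < ε → ∃ δ : ℝ, 0 < δ ∧ ∀ c c' : ℝ, |c - c'| ≤ δ → |Real.sin (n * c) - Real.sin (n * c')| ≤ ε := by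
  intro ε hε
  have hn1 : 0 < (n : ℝ) + 1 := by positivity
  refine ⟨ε / (n + 1), div_pos hε hn1, fun c c' hd => ?_⟩
  calc |Real.sin (n * c) - Real.sin (n * c')| ≤ |n * c - n * c'| := Real.abs_sin_sub_sin_le _ _
    _ = n * |c - c'| := by rw [← mul_sub, abs_mul, Nat.abs_cast]
    _ ≤ (n + 1) * |c - c'| := mul_le_mul_of_nonneg_right (by linarith) (abs_nonneg _)
    _ ≤ (n + 1) * (ε / (n + 1)) := mul_le_mul_of_nonneg_left hd hn1.le
    _ = ε := mul_div_cancel₀ ε hn1.ne'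

/-- **… YET THE RUN-UNIFORM [UC-LAST] FAILS**: no `δ > 0` serves `ε = 1∕2` for every run on `I = [0, 1]` — at run `n ≥ max(2, π∕2δ)` the
last couplings `0` and `π∕(2n)` are `δ`-close and the values `sin 0 = 0`, `sin(π∕2) = 1` are `1` apart.  So holomorphy on a uniform
thickening + a run-uniform bound on the REAL class + per-run moduli do NOT give the clause. [folklore] -/
theorem sinFamily_not_uniformLast :
    ¬ (∀ ε : ℝ, 0 < ε → ∃ δ : ℝ, 0 < δ ∧ ∀ n : ℕ, ∀ c ∈ Icc (0 : ℝ) 1, ∀ c' ∈ Icc (0 : ℝ) 1,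
        |c - c'| ≤ δ → |Real.sin (n * c) - Real.sin (n * c')| ≤ ε) := by
  intro h
  obtain ⟨δ, hδ, h⟩ := h (1 / 2) (by norm_num)
  obtain ⟨N, hN⟩ := exists_nat_gt (Real.pi / (2 * δ))
  set n : ℕ := N + 2 with hn
  have hn2 : (2 : ℝ) ≤ n := by
    rw [hn]; push_cast; linarith [(Nat.cast_nonneg N : (0 : ℝ) ≤ N)]
  have hn0 : (0 : ℝ) < n := by linarith
  have hnN : Real.pi / (2 * δ) < n := by
    rw [hn]; push_cast; linarith
  have hpi := Real.pi_pos
  -- the second coupling `c' = π/(2n)`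
  have hc'0 : 0 ≤ Real.pi / (2 * n) := by positivity
  have hc'1 : Real.pi / (2 * n) ≤ 1 := by
    rw [div_le_one (by positivity)]
    linarith [Real.pi_le_four]
  have hc'δ : Real.pi / (2 * n) ≤ δ := by
    rw [div_le_iff₀ (by positivity)]
    have := (div_lt_iff₀ (by positivity : (0 : ℝ) < 2 * δ)).mp hnN
    linarith
  have key := h n 0 ⟨le_rfl, zero_le_one⟩ (Real.pi / (2 * n)) ⟨hc'0, hc'1⟩
    (by rw [zero_sub, abs_neg, abs_of_nonneg hc'0]; exact hc'δ)
  have heval : (n : ℝ) * (Real.pi / (2 * n)) = Real.pi / 2 := by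
    field_simp
  rw [mul_zero, Real.sin_zero, heval, Real.sin_pi_div_two] at key
  norm_num at key

/-- **… BECAUSE NO RUN-UNIFORM BOUND HOLDS ON ANY COMPLEX THICKENING**: at the point `iϱ` of the closed `ϱ`-disc about `0 ∈ [0, 1]`,
`‖sin(n·iϱ)‖ = sinh(nϱ) ≥ nϱ` exceeds every `M` for large `n`.  The missing clause of `uniformLast_of_margin` is exactly this one. [folklore] -/
theorem sinFamily_unbounded_on_thickening {ϱ : ℝ} (hϱ : 0 < ϱ) (M : ℝ) :
    ((ϱ : ℂ) * Complex.I) ∈ closedBall ((0 : ℝ) : ℂ) ϱ ∧ ∃ n : ℕ, M < ‖Complex.sin (n * ((ϱ : ℂ) * Complex.I))‖ := by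
  refine ⟨?_, ?_⟩
  · rw [mem_closedBall, Complex.ofReal_zero, dist_zero_right, norm_mul, Complex.norm_real, Complex.norm_I, mul_one,
      Real.norm_eq_abs, abs_of_pos hϱ]
  · obtain ⟨n, hn⟩ := exists_nat_gt (M / ϱ)
    refine ⟨n, ?_⟩
    have hcast : (n : ℂ) * ((ϱ : ℂ) * Complex.I) = ((n * ϱ : ℝ) : ℂ) * Complex.I := by push_cast; ring
    rw [hcast, Complex.sin_mul_I, ← Complex.ofReal_sinh, norm_mul, Complex.norm_I, mul_one, Complex.norm_real,
      Real.norm_eq_abs]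
    have hnϱ : 0 ≤ (n : ℝ) * ϱ := by positivity
    have hM : M < n * ϱ := (div_lt_iff₀ hϱ).mp hn
    calc M < n * ϱ := hM
      _ ≤ Real.sinh (n * ϱ) := Real.self_le_sinh_iff.mpr hnϱ
      _ ≤ |Real.sinh (n * ϱ)| := le_abs_self _

/-- **THE MARGIN SOURCE (c) IS NOT CONTAINED IN THE STABILISATION SOURCE (b)** (cf. `DirectPairingRunLimit.stepUC_of_stabilising`): the
run-indexed family `c ↦ (−1)^n·c` (as a map `ℂ → ℂ`, constant in the old datum) has margin `1` and bound `2` on the `1`-thickening of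
`I = [0, 1]` for EVERY run — so `uniformLast_of_margin` applies — but does NOT stabilise in the run (at `c = 1` consecutive runs are `2`
apart).  Together with gen 8's `DirectPairingRunLimitWitness` (stabilising, not eventually constant) the three sufficient sources of C35 are
related by (a) ⊊ (b), (c) ⊄ (b). [folklore] -/
theorem flipFamily_margin_not_stabilising :
    (∀ n : ℕ, DifferentiableOn ℂ (fun z : ℂ => (-1 : ℂ) ^ n * z) (closedBall (0 : ℂ) 2) ∧
      (∀ z ∈ closedBall (0 : ℂ) 2, ‖(-1 : ℂ) ^ n * z‖ ≤ 2) ∧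
      ∀ c ∈ Icc (0 : ℝ) 1, closedBall (c : ℂ) 1 ⊆ closedBall (0 : ℂ) 2) ∧
    ¬ (∀ ε : ℝ, 0 < ε → ∃ n₀ : ℕ, ∀ n, n₀ ≤ n → ∀ c ∈ Icc (0 : ℝ) 1,
        dist ((-1 : ℂ) ^ n * (c : ℂ)) ((-1 : ℂ) ^ n₀ * (c : ℂ)) ≤ ε) := by
  refine ⟨fun n => ⟨?_, ?_, ?_⟩, ?_⟩
  · exact (differentiable_id.const_mul ((-1 : ℂ) ^ n)).differentiableOn
  · intro z hz
    rw [mem_closedBall, dist_zero_right] at hz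
    rwa [norm_mul, norm_pow, norm_neg, norm_one, one_pow, one_mul]
  · intro c hc
    refine closedBall_subset_closedBall' ?_
    rw [Complex.dist_eq, sub_zero, Complex.norm_real, Real.norm_eq_abs, abs_of_nonneg hc.1]
    linarith [hc.2]
  · intro h
    obtain ⟨n₀, hn₀⟩ := h 1 one_pos
    have key := hn₀ (n₀ + 1) (Nat.le_succ n₀) 1 ⟨zero_le_one, le_rfl⟩
    rw [Complex.ofReal_one, mul_one, mul_one, pow_succ, Complex.dist_eq] at key
    have h2 : ‖(-1 : ℂ) ^ n₀ * -1 - (-1) ^ n₀‖ = 2 := by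
      rw [show (-1 : ℂ) ^ n₀ * -1 - (-1) ^ n₀ = (-2) * (-1) ^ n₀ by ring, norm_mul, norm_pow, norm_neg, norm_neg,
        norm_one, one_pow, mul_one]
      norm_num
    rw [h2] at key
    norm_num at key

end Summit.QuantumFields.BalabanUV.T4Continuum.NE9.DirectPairingMargin
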